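import Summits.AtomisticToContinuum.BoseEinsteinCondensation.Theorems.BECStronglyRayleighLatticeToPeriodicBridgeCoarseCellDefs
import Literature.MathematicalPhysics.QuantumManyBody.CondensateOccupationStability
import Literature.Barriers.AtomisticToContinuum.KineticGapLengthScalesThermodynamicWindow

/-!
# Route `BECStronglyRayleigh`, crux `LatticeToPeriodicBridge` (stmt-AtomisticToContinuum-9674),
# line `coarse-cell-lorentzian` — stub S6 `stub_positiveTransfer`

Stub file of the crux line `coarse-cell-lorentzian` (skeleton
`Summits/AtomisticToContinuum/BoseEinsteinCondensation/Cruxes/LatticeToPeriodicBridge/Lines/coarse-cell-lorentzian.lean`),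
landed `--supports stmt-AtomisticToContinuum-9674`: it proves the registered signature `Sig.stub_positiveTransfer`
of the line's `Defs` module (`Theorems/BECStronglyRayleighLatticeToPeriodicBridgeCoarseCellDefs.lean`) BY NAME, in
the skeleton's namespace.

**Statement (S6, positive transfer).** Taking the two fixed-`N` route items `PeriodicRigidity`
(stmt-AtomisticToContinuum-9467) and `PositivePeriodicNearMinimiser` (stmt-AtomisticToContinuum-14006) BY
NAME as antecedents: for every repulsive finite-range `v` there is `ρ_r > 0` such that for `0 < ρ < ρ_r`
and every level `c₁ > 0`, eventually in `N`, if at some slack `δ₁ > 0` every REAL NON-NEGATIVE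
`δ₁`-near-minimiser of the periodic energy on the torus of side `L_N = (N/ρ)^{1/3}` has `n₀ ≥ c₁N`, then
at some slack `δ > 0` every `δ`-near-minimiser has `n₀ ≥ (c₁/4)N`.

**Proof.** `ρ_r := min(ρ₀, ρ₁)` with `ρ₀` the threshold of `PeriodicRigidity` and `ρ₁` that of
`exists_eventually_periodicGroundStateEnergy_lt_top` (`E₀^per(N, L_N) < ∞` eventually). Fix `ρ, c₁`,
put `η := (3c₁/8)²` (so `2√η = 3c₁/4`) and work at an `N ≥ 1` in the eventual ranges of rigidity at
tolerance `η` (slack `δ_R`) and of finiteness. Given `δ₁` and the hypothesis on real non-negative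
near-minimisers, put `δ := min(δ₁, δ_R)`. `PositivePeriodicNearMinimiser` supplies a `δ`-near-minimiser
`Ψ = |Ψ|`, which is real non-negative, so `n₀(Ψ) ≥ c₁N`. For any `δ`-near-minimiser `Φ`, rigidity gives
a unit `c` with `∫_{Λ^N}|Ψ - cΦ|² ≤ η`; the `L²`-Lipschitz bound of the condensate occupation on the unit
ball (`condensateOccupation_le_add_lintegral_rpow`) and phase invariance
(`condensateOccupation_const_mul_of_norm_eq_one`) give `n₀(Ψ) ≤ n₀(Φ) + 2N√η = n₀(Φ) + (3c₁/4)N`,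
whence `n₀(Φ) ≥ (c₁/4)N`.

References: LSSY2005 §1.2, App. A (A.11), (A.13); Fournais2020 (1.1)–(1.5); ReedSimonIV1978 XIII.12/47.
-/

noncomputable section

open MeasureTheory Filter
open scoped ENNReal Topology

namespace Summit.AtomisticToContinuum.BoseEinsteinCondensation.Cruxes.LatticeToPeriodicBridge.CoarseCellLorentzian

open Literature.MathematicalPhysics.QuantumManyBody.BoseGas
open Literature.Barriers.AtomisticToContinuum.BoseGas
open Summit.AtomisticToContinuum.BoseEinsteinCondensation.Theses

/-! ## Fixed-volume lemmas -/

namespace PositiveTransfer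

/-- A unit complex number has `(‖c‖₊)² = 1` in `ℝ≥0∞`. [folklore] -/
theorem coe_nnnorm_sq_eq_one_of_norm_eq_one {c : ℂ} (hc : ‖c‖ = 1) : ((‖c‖₊ : ℝ≥0∞) ^ 2) = 1 := by
  rw [← enorm_eq_nnnorm, ← ofReal_norm, hc]
  simp

/-- **Occupation transfer along a unit phase at `L²`-distance `√η`** (fixed `N`, `L`): if the periodic
trial states `Ψ, Φ` satisfy `∫⁻_{Λ^N} ‖Ψ - cΦ‖₊² ≤ η` for a unit `c`, then
`n₀(Ψ) ≤ n₀(Φ) + 2N√η` — phase invariance of `n₀` and its `L²`-Lipschitz continuity on the unit ball.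
[cite: LSSY2005, App. A (A.11), (A.13)] -/
theorem condensateOccupation_le_add_of_unit_mul_lintegral_le {N : ℕ} {L : ℝ} (hL : 0 < L)
    (Ψ Φ : PeriodicTrialState N L) {c : ℂ} (hc : ‖c‖ = 1) {η : ℝ} (hη : 0 ≤ η)
    (h : ∫⁻ X in cellN N L, (‖Ψ.ψ X - c * Φ.ψ X‖₊ : ℝ≥0∞) ^ 2 ≤ ENNReal.ofReal η) :
    condensateOccupation N L Ψ.ψ ≤
      condensateOccupation N L Φ.ψ + ENNReal.ofReal (2 * N * Real.sqrt η) := by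
  have hcont : Continuous fun X => c * Φ.ψ X := continuous_const.mul Φ.contDiff.continuous
  have hnorm1 : ∫⁻ X in cellN N L, (‖c * Φ.ψ X‖₊ : ℝ≥0∞) ^ 2 ≤ 1 := by
    simp only [coe_nnnorm_mul_sq, coe_nnnorm_sq_eq_one_of_norm_eq_one hc, one_mul]
    exact Φ.norm_eq.le
  have hlip := condensateOccupation_le_add_lintegral_rpow hL Ψ.contDiff.continuous hcont
    Ψ.norm_eq.le hnorm1
  rw [condensateOccupation_const_mul_of_norm_eq_one N L hc] at hlip
  calc condensateOccupation N L Ψ.ψ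
      ≤ condensateOccupation N L Φ.ψ +
          2 * N * (∫⁻ X in cellN N L, (‖Ψ.ψ X - c * Φ.ψ X‖₊ : ℝ≥0∞) ^ 2) ^ (1 / 2 : ℝ) := hlip
    _ ≤ condensateOccupation N L Φ.ψ + 2 * N * (ENNReal.ofReal η) ^ (1 / 2 : ℝ) := by
        gcongr
    _ = condensateOccupation N L Φ.ψ + ENNReal.ofReal (2 * N * Real.sqrt η) := by
        rw [ofReal_rpow_half_eq_sqrt hη, two_mul_natCast_mul_ofReal N (Real.sqrt η)]

/-- **Positive transfer at fixed volume.** On a torus of side `L > 0` with `N` bosons, suppose: any two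
`δ_R`-near-minimisers are `η`-close in `L²(Λ^N)` up to a unit phase, with `2√η ≤ 3c₁/4`; some
`min(δ₁, δ_R)`-near-minimiser is of the form `Ψ = |Ψ|`; and every real non-negative `δ₁`-near-minimiser has
`n₀ ≥ c₁N`. Then every `min(δ₁, δ_R)`-near-minimiser has `n₀ ≥ (c₁/4)N`. [folklore] -/
theorem positiveTransfer_fixedVolume {N : ℕ} {L : ℝ} (hL : 0 < L) (v : ℝ → ℝ≥0∞) {c₁ η : ℝ}
    (hc₁ : 0 ≤ c₁) (hη : 0 ≤ η) (hηc : 2 * Real.sqrt η ≤ 3 * c₁ / 4) {δ₁ δR : ℝ≥0∞}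
    (hrig : ∀ Ψ Φ : PeriodicTrialState N L,
      periodicEnergy v Ψ ≤ periodicGroundStateEnergy v N L + δR →
      periodicEnergy v Φ ≤ periodicGroundStateEnergy v N L + δR →
        ∃ c : ℂ, ‖c‖ = 1 ∧
          ∫⁻ X in cellN N L, (‖Ψ.ψ X - c * Φ.ψ X‖₊ : ℝ≥0∞) ^ 2 ≤ ENNReal.ofReal η)
    (hpos : ∃ Ψ : PeriodicTrialState N L,
      periodicEnergy v Ψ ≤ periodicGroundStateEnergy v N L + min δ₁ δR ∧
        ∀ X, Ψ.ψ X = (‖Ψ.ψ X‖ : ℂ))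
    (H : ∀ Ψ : PeriodicTrialState N L, (∀ X, 0 ≤ (Ψ.ψ X).re ∧ (Ψ.ψ X).im = 0) →
      periodicEnergy v Ψ ≤ periodicGroundStateEnergy v N L + δ₁ →
        ENNReal.ofReal (c₁ * N) ≤ condensateOccupation N L Ψ.ψ)
    (Φ : PeriodicTrialState N L)
    (hΦ : periodicEnergy v Φ ≤ periodicGroundStateEnergy v N L + min δ₁ δR) :
    ENNReal.ofReal (c₁ / 4 * N) ≤ condensateOccupation N L Φ.ψ := by
  obtain ⟨Ψ, hΨE, hΨpos⟩ := hpos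
  -- `Ψ = |Ψ|` is real non-negative, so the hypothesis applies to it
  have hΨreal : ∀ X, 0 ≤ (Ψ.ψ X).re ∧ (Ψ.ψ X).im = 0 := fun X => by
    rw [hΨpos X]
    exact ⟨by simp, by simp⟩
  have hΨocc : ENNReal.ofReal (c₁ * N) ≤ condensateOccupation N L Ψ.ψ :=
    H Ψ hΨreal (hΨE.trans (add_le_add le_rfl (min_le_left _ _)))
  -- rigidity: `Φ` is `η`-close to `Ψ` up to a unit phase
  obtain ⟨c, hc, hdist⟩ := hrig Ψ Φ (hΨE.trans (add_le_add le_rfl (min_le_right _ _)))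
    (hΦ.trans (add_le_add le_rfl (min_le_right _ _)))
  have hlip := condensateOccupation_le_add_of_unit_mul_lintegral_le hL Ψ Φ hc hη hdist
  -- bookkeeping: `c₁ N ≤ n₀(Φ) + 2N√η ≤ n₀(Φ) + (3c₁/4) N`
  have hstep : ENNReal.ofReal (c₁ * N) ≤
      condensateOccupation N L Φ.ψ + ENNReal.ofReal (3 * c₁ / 4 * N) := by
    refine hΨocc.trans (hlip.trans ?_)
    gcongr condensateOccupation N L Φ.ψ + ENNReal.ofReal ?_
    calc 2 * (N : ℝ) * Real.sqrt η = (2 * Real.sqrt η) * N := by ring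
      _ ≤ 3 * c₁ / 4 * N := by gcongr
  have key := ofReal_sub_mul_le_of_le_add (c := c₁) (ε := 3 * c₁ / 4) (by positivity) N hstep
  have hring : c₁ / 4 * (N : ℝ) = (c₁ - 3 * c₁ / 4) * N := by ring
  rw [hring]
  exact key

end PositiveTransfer

/-! ## The stub -/

/-- **S6 — positive transfer** (stub `stub_positiveTransfer` of line `coarse-cell-lorentzian`, crux
stmt-AtomisticToContinuum-9674): given `PeriodicRigidity` (stmt-9467) and `PositivePeriodicNearMinimiser`
(stmt-14006) by name, condensation `n₀ ≥ c₁N` of all real non-negative `δ₁`-near-minimisers transfers,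
eventually along the thermodynamic sequence at small density, to `n₀ ≥ (c₁/4)N` for all `δ`-near-minimisers
at some slack `δ > 0`. Thresholds: `ρ_r = min(ρ₀, ρ₁)` (rigidity, finiteness of `E₀^per`), tolerance
`η = (3c₁/8)²` fixed before `N`, `δ = min(δ₁, δ_R)`. [folklore] -/
theorem stub_positiveTransfer : Sig.stub_positiveTransfer := by
  intro hR hP v hv
  obtain ⟨ρ₀, hρ₀, hrig⟩ := hR v hv
  obtain ⟨ρ₁, hρ₁, hfin⟩ := exists_eventually_periodicGroundStateEnergy_lt_top hv
  refine ⟨min ρ₀ ρ₁, lt_min hρ₀ hρ₁, fun ρ hρ hρr c₁ hc₁ => ?_⟩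
  have hη : (0 : ℝ) < (3 * c₁ / 8) ^ 2 := by positivity
  filter_upwards [hrig ρ hρ (hρr.trans_le (min_le_left _ _)) _ hη,
    hfin ρ hρ (hρr.trans_le (min_le_right _ _)), eventually_gt_atTop 0] with N hRN hEN hN
  obtain ⟨δR, hδR, hRN⟩ := hRN
  intro δ₁ hδ₁ H
  have hL : 0 < sideLength ρ N := sideLength_pos_of_pos hρ hN
  refine ⟨min δ₁ δR, lt_min hδ₁ hδR, fun Φ hΦ => ?_⟩
  have hsqrt : 2 * Real.sqrt ((3 * c₁ / 8) ^ 2) ≤ 3 * c₁ / 4 := by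
    rw [Real.sqrt_sq (by positivity)]
    linarith
  exact PositiveTransfer.positiveTransfer_fixedVolume hL v hc₁.le hη.le hsqrt hRN
    (hP v N (sideLength ρ N) hEN.ne _ (lt_min hδ₁ hδR)) H Φ hΦ

end Summit.AtomisticToContinuum.BoseEinsteinCondensation.Cruxes.LatticeToPeriodicBridge.CoarseCellLorentzian

end
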